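import Summits.BirchSwinnertonDyer.BirchSwinnertonDyer.Theorems.GenusKolyvaginAtTwoGenusPrimitiveSupplyAtTwoArchimedeanRelaxedSwitch
import Summits.BirchSwinnertonDyer.BirchSwinnertonDyer.Theorems.GenusKolyvaginAtTwoGenusPrimitiveSupplyAtTwoArchimedeanEgg
import HarnessLib

/-!
# Route `GenusKolyvaginAtTwo`, crux #2 `GenusPrimitiveSupplyAtTwo` (stmt-BirchSwinnertonDyer-22136):
# the ∞-SWITCH READ ON THE EGG — `[Sel₂^{rel ∞}(E) : Sel₂(E)] = 1` iff `E(ℚ)` meets the egg (`ε = +1`), `= 2` iff `E(ℚ) ⊂ E⁰(ℝ)`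
# (`ε = −1`), on `Δ > 0`, `E(ℚ)[2] = 0`, `Ш[2] = 0`; and `#Sel₂^{rel ∞}(E) = 4` resp. `2` in rank one (the `R` of the two-transposition door)

Width seat `bsd-line-gk2-p5` g14 (cell `bsd-f1-sign2`, SUPPLY lineage of crux 22136), file 29 of the series; sequel of file 28
(`…ArchimedeanRelaxedSwitch`: Mazur–Rubin Lemma 3.2 at `T = {∞}` in the kernel) and of file 22 (`…ArchimedeanEgg`: «the egg is the real
place of `Sel₂(W)`», `GenusKolyArch.meetsEgg_iff_exists_localization_inl_ne_zero`). THEOREMS ONLY (no definition, no named fact, no `sorry`);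
helper `--supports stmt-BirchSwinnertonDyer-22136`; no item is closed; BSD is not proved by any of this.

* §119 `natCard_mul_relIndex_eq_natCard` (group theory: `#H · [K : H] = #K` for `H ≤ K`, no finiteness of the ambient group).
* §120 **`relIndex_selmerGroup_selmerGroupRelaxedAtInfinityAtTwo_eq_one_of_meetsEgg`** (EVERY elliptic `W/ℚ`: a rational point on the egg gives
  a Selmer class non-trivial at `∞`, hence the DOWN branch `Sel₂^{rel ∞} = Sel₂`), **`…_eq_two_of_not_meetsEgg`** (`Δ > 0`, `E(ℚ)[2] = 0`,
  `Ш(W)[2] = 0`, `E(ℚ) ⊂ E⁰(ℝ)` ⟹ UP branch), and the dichotomy **`…_eq_two_iff_not_meetsEgg`** / **`…_eq_one_iff_meetsEgg`** — the bit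
  `ε(W)` of the cell's descent-sign rows (T-C `EggTwistLawAtTwo`, DESC-§17/§18) IS the ∞-switch of `Sel₂(W)`.
* §122 `natCard_map_localization_inl_selmerGroupRelaxedAtInfinityAtTwo_eq` — the image of `Sel₂^{rel ∞}(E)` in `H¹(ℝ, E[2])` has exactly
  `#𝓛_∞` elements (`2` for `Δ > 0`: a line in the Klein four-group — the counting half of -desc's DESC-§18-T1).
* §121 rank one: **`natCard_selmerGroupRelaxedAtInfinityAtTwo_eq_four_of_not_meetsEgg`** (`ε = −1`: `#R = 4`, the `R = ⟨δP₀, c_∞⟩` of the -an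
  lens's T-2q `TwoTranspositionTwistLawAtTwo`) and **`…_eq_two_of_meetsEgg`** (`ε = +1`: `R = Sel₂ = ⟨δP₀⟩`).

Honest framing: KNOWN in print (Mazur–Rubin 2010 Lemma 3.2 at an archimedean place + Kramer 1981 Prop. 6); kernel-new; beyond-print theorem: no.
Crux 22136 stays OPEN exactly at (U) 24947 ∧ (CONV₂) 19220/24948. BSD is not proved by any of this.

References: [MazurRubin2010] Def. 3.1, Lemma 3.2 (arXiv:0904.3709 p. 8); [Kramer1981] §2 Prop. 6 (p. 127); [SilvermanAEC2009] Thm. X.4.2 (a).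
-/

set_option linter.dupNamespace false -- tree convention: `Summit.BirchSwinnertonDyer.BirchSwinnertonDyer.Theorems` (summit = sub-problem)
set_option autoImplicit false

noncomputable section

open scoped Classical

open NumberField IsDedekindDomain WeierstrassCurve
open Literature.NumberTheory.EllipticCurves Literature.NumberTheory.GaloisRepresentations
open Literature.NumberTheory.GaloisRepresentations.DiscreteGaloisModule (SelmerStructure)
open Literature.NumberTheory.GaloisCohomology
open Summit.BirchSwinnertonDyer.Rank1Residual.F1Sign2 (selmerGroupRelaxedAtInfinityAtTwo selmerGroup_le_selmerGroupRelaxedAtInfinityAtTwo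
  NoRationalTwoTorsion ShaTwoTrivial MeetsEgg selmerTwoCard)

namespace Summit.BirchSwinnertonDyer.BirchSwinnertonDyer.Theorems.GenusKolyArch

/-! ## §119 `#H · [K : H] = #K` for nested subgroups -/

section GroupTheory

/-- **`#H · [K : H] = #K` for subgroups `H ≤ K`** of an arbitrary (possibly infinite) additive group: Lagrange inside `K`
(`(H.addSubgroupOf K).card_mul_index` with `H.addSubgroupOf K ≃+ H`). [folklore] -/
theorem natCard_mul_relIndex_eq_natCard {G : Type*} [AddGroup G] {H K : AddSubgroup G} (h : H ≤ K) :
    Nat.card H * H.relIndex K = Nat.card K := by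
  rw [AddSubgroup.relIndex, ← Nat.card_congr (AddSubgroup.addSubgroupOfEquivOfLe h).toEquiv]
  exact (H.addSubgroupOf K).card_mul_index

end GroupTheory

variable (W : WeierstrassCurve ℚ) [W.IsElliptic]

/-! ## §120 The ∞-switch read on the egg -/

section Egg

/-- **A rational point on the egg forces the DOWN branch: `[Sel₂^{rel ∞}(E) : Sel₂(E)] = 1`** for EVERY elliptic `W/ℚ` (for `Δ < 0` the
index is `1` anyway; for `Δ > 0` the Kummer class of the egg point is a Selmer class with `res_∞ ≠ 0`, file 22, and file 28's switch applies).
[cite: MazurRubin2010, Lemma 3.2 (arXiv:0904.3709 p. 8)] [cite: Kramer1981, §2 Prop. 6 (p. 127)] -/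
theorem relIndex_selmerGroup_selmerGroupRelaxedAtInfinityAtTwo_eq_one_of_meetsEgg (hegg : MeetsEgg W) :
    (W.selmerGroup ((2 : ℕ) : ℤ)).relIndex (selmerGroupRelaxedAtInfinityAtTwo W) = 1 := by
  have hΔ : W.Δ ≠ 0 := by rw [← WeierstrassCurve.coe_Δ']; exact W.Δ'.ne_zero
  rcases lt_or_gt_of_ne hΔ with hneg | hpos
  · exact relIndex_selmerGroup_selmerGroupRelaxedAtInfinityAtTwo_eq_one_of_Δ_neg W hneg
  · obtain ⟨c, hc, hne⟩ := exists_mem_selmerGroup_localization_inl_ne_zero_of_meetsEgg W hegg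
    exact (relIndex_selmerGroup_selmerGroupRelaxedAtInfinityAtTwo_eq_one_iff_of_Δ_pos W hpos Rat.infinitePlace).mpr
      ⟨c, (SetLike.ext_iff.mp (W.selmerGroup_eq_selmerGroup_kummerSelmerStructure _) c).mpr hc, hne⟩

/-- **A rational point on the egg ⟹ `Sel₂^{rel ∞}(E) = Sel₂(E)`.** [cite: MazurRubin2010, Lemma 3.2 (arXiv:0904.3709 p. 8)] -/
theorem selmerGroupRelaxedAtInfinityAtTwo_eq_selmerGroup_of_meetsEgg (hegg : MeetsEgg W) :
    selmerGroupRelaxedAtInfinityAtTwo W = W.selmerGroup ((2 : ℕ) : ℤ) := by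
  have h1 := relIndex_selmerGroup_selmerGroupRelaxedAtInfinityAtTwo_eq_one_of_meetsEgg W hegg
  rw [AddSubgroup.relIndex_eq_one] at h1
  exact le_antisymm h1 (selmerGroup_le_selmerGroupRelaxedAtInfinityAtTwo W)

/-- **`E(ℚ) ⊂ E⁰(ℝ)` forces the UP branch: `[Sel₂^{rel ∞}(E) : Sel₂(E)] = 2`** for `Δ > 0`, `E(ℚ)[2] = 0`, `Ш(W)[2] = 0` (then every Selmer class
is a Kummer class `κ(P)`, `P ∈ 2E(ℝ)` off the egg, so `res_∞ Sel₂ = 0`: file 22; file 28's switch).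
[cite: MazurRubin2010, Lemma 3.2 (arXiv:0904.3709 p. 8)] [cite: Kramer1981, §2 Prop. 6 (p. 127)] -/
theorem relIndex_selmerGroup_selmerGroupRelaxedAtInfinityAtTwo_eq_two_of_not_meetsEgg (hΔ : 0 < W.Δ) (hT : NoRationalTwoTorsion W)
    (hSha : ShaTwoTrivial W) (hegg : ¬ MeetsEgg W) :
    (W.selmerGroup ((2 : ℕ) : ℤ)).relIndex (selmerGroupRelaxedAtInfinityAtTwo W) = 2 :=
  (relIndex_selmerGroup_selmerGroupRelaxedAtInfinityAtTwo_eq_two_iff_of_Δ_pos W hΔ Rat.infinitePlace).mpr fun c hc =>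
    forall_mem_selmerGroup_localization_inl_eq_zero_of_not_meetsEgg W hΔ hT hSha hegg c
      ((SetLike.ext_iff.mp (W.selmerGroup_eq_selmerGroup_kummerSelmerStructure _) c).mp hc)

/-- **THE BIT `ε(W)` IS THE ∞-SWITCH**: for `Δ > 0`, `E(ℚ)[2] = 0`, `Ш(W)[2] = 0`, `[Sel₂^{rel ∞}(E) : Sel₂(E)] = 2 ⟺ E(ℚ) ⊂ E⁰(ℝ)`
(`¬ MeetsEgg`, `ε = −1`). [cite: MazurRubin2010, Lemma 3.2 (arXiv:0904.3709 p. 8)] [cite: Kramer1981, §2 Prop. 6 (p. 127)] -/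
theorem relIndex_selmerGroup_selmerGroupRelaxedAtInfinityAtTwo_eq_two_iff_not_meetsEgg (hΔ : 0 < W.Δ) (hT : NoRationalTwoTorsion W)
    (hSha : ShaTwoTrivial W) :
    (W.selmerGroup ((2 : ℕ) : ℤ)).relIndex (selmerGroupRelaxedAtInfinityAtTwo W) = 2 ↔ ¬ MeetsEgg W := by
  constructor
  · intro h2 hegg
    have h1 := relIndex_selmerGroup_selmerGroupRelaxedAtInfinityAtTwo_eq_one_of_meetsEgg W hegg
    omega
  · exact relIndex_selmerGroup_selmerGroupRelaxedAtInfinityAtTwo_eq_two_of_not_meetsEgg W hΔ hT hSha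

/-- … and `[Sel₂^{rel ∞}(E) : Sel₂(E)] = 1 ⟺ E(ℚ)` meets the egg (`ε = +1`), same hypotheses.
[cite: MazurRubin2010, Lemma 3.2 (arXiv:0904.3709 p. 8)] [cite: Kramer1981, §2 Prop. 6 (p. 127)] -/
theorem relIndex_selmerGroup_selmerGroupRelaxedAtInfinityAtTwo_eq_one_iff_meetsEgg (hΔ : 0 < W.Δ) (hT : NoRationalTwoTorsion W)
    (hSha : ShaTwoTrivial W) :
    (W.selmerGroup ((2 : ℕ) : ℤ)).relIndex (selmerGroupRelaxedAtInfinityAtTwo W) = 1 ↔ MeetsEgg W := by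
  constructor
  · intro h1
    by_contra hegg
    have h2 := relIndex_selmerGroup_selmerGroupRelaxedAtInfinityAtTwo_eq_two_of_not_meetsEgg W hΔ hT hSha hegg
    omega
  · exact relIndex_selmerGroup_selmerGroupRelaxedAtInfinityAtTwo_eq_one_of_meetsEgg W

end Egg

/-! ## §121 Rank one: `#Sel₂^{rel ∞}(E) = 4` at `ε = −1`, `= 2` at `ε = +1` -/

section RankOne

omit [W.IsElliptic] in
/-- **`#Sel₂^{rel ∞}(E) = [Sel₂^{rel ∞} : Sel₂] · #Sel₂(E)`**, and `#Sel₂(W) = selmerTwoCard W`. [folklore] -/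
theorem natCard_selmerGroupRelaxedAtInfinityAtTwo_eq_mul :
    Nat.card (selmerGroupRelaxedAtInfinityAtTwo W) =
      selmerTwoCard W * (W.selmerGroup ((2 : ℕ) : ℤ)).relIndex (selmerGroupRelaxedAtInfinityAtTwo W) := by
  rw [← natCard_mul_relIndex_eq_natCard (selmerGroup_le_selmerGroupRelaxedAtInfinityAtTwo W)]
  rfl

/-- **`ε = −1`, rank one: `#Sel₂^{rel ∞}(E) = 4`** — for `Δ > 0`, `E(ℚ)[2] = 0`, rank `1`, `Ш(W)[2] = 0` and `E(ℚ) ⊂ E⁰(ℝ)`: `#Sel₂(E) = 2`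
(file 22 `selmerTwoCard_eq_two_of_rank_one`) and the UP branch. This is the order of the -an lens's `R = ⟨δP₀, c_∞⟩` at the two-transposition
door (T-2q `F1Sign2.TwoDoor.TwoTranspositionTwistLawAtTwo`). [cite: MazurRubin2010, Lemma 3.2 (arXiv:0904.3709 p. 8)] [cite: Kramer1981, §2 Prop. 6 (p. 127)] -/
theorem natCard_selmerGroupRelaxedAtInfinityAtTwo_eq_four_of_not_meetsEgg (hΔ : 0 < W.Δ) (hT : NoRationalTwoTorsion W)
    (hrank : W.mordellWeilRank = 1) (hSha : ShaTwoTrivial W) (hegg : ¬ MeetsEgg W) :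
    Nat.card (selmerGroupRelaxedAtInfinityAtTwo W) = 4 := by
  rw [natCard_selmerGroupRelaxedAtInfinityAtTwo_eq_mul W, selmerTwoCard_eq_two_of_rank_one W hT hrank hSha,
    relIndex_selmerGroup_selmerGroupRelaxedAtInfinityAtTwo_eq_two_of_not_meetsEgg W hΔ hT hSha hegg]

/-- **`ε = +1`, rank one: `#Sel₂^{rel ∞}(E) = 2`** (`Sel₂^{rel ∞} = Sel₂ = ⟨δP₀⟩`) — for `E(ℚ)[2] = 0`, rank `1`, `Ш(W)[2] = 0` and a rational
point on the egg. [cite: MazurRubin2010, Lemma 3.2 (arXiv:0904.3709 p. 8)] [cite: Kramer1981, §2 Prop. 6 (p. 127)] -/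
theorem natCard_selmerGroupRelaxedAtInfinityAtTwo_eq_two_of_meetsEgg (hT : NoRationalTwoTorsion W)
    (hrank : W.mordellWeilRank = 1) (hSha : ShaTwoTrivial W) (hegg : MeetsEgg W) :
    Nat.card (selmerGroupRelaxedAtInfinityAtTwo W) = 2 := by
  rw [natCard_selmerGroupRelaxedAtInfinityAtTwo_eq_mul W, selmerTwoCard_eq_two_of_rank_one W hT hrank hSha,
    relIndex_selmerGroup_selmerGroupRelaxedAtInfinityAtTwo_eq_one_of_meetsEgg W hegg]

end RankOne

/-! ## §122 The image of `Sel₂^{rel ∞}(E)` at the real place has exactly `#𝓛_∞` elements -/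

section Image

/-- **`Sel₂^{str ∞}(E) = ker(loc_∞) ⊓ Sel₂^{rel ∞}(E)`** as subgroups of `H¹(ℚ, E[2])`. [cite: MazurRubin2010, Def. 3.1 (arXiv:0904.3709 p. 8)] -/
theorem selmerGroup_kummerStrict_singleton_inl_eq_ker_inf (w : InfinitePlace ℚ) :
    (Summit.BirchSwinnertonDyer.Rank1Residual.X11b.KummerPT.kummerStrict W 2 {(Sum.inl w : Place ℚ)}).selmerGroup =
      (galoisCohomology.localization (W.torsionGaloisModule ((2 : ℕ) : ℤ)) (Sum.inl w) 1).ker ⊓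
        selmerGroupRelaxedAtInfinityAtTwo W := by
  ext c
  refine (mem_selmerGroup_kummerStrict_singleton_inl_iff W w c).trans ?_
  rw [AddSubgroup.mem_inf, AddMonoidHom.mem_ker]
  exact and_comm

/-- **`#loc_∞(Sel₂^{rel ∞}(E)) = #𝓛_∞`**: the image of the ∞-relaxed `2`-Selmer group in `H¹(ℝ, E[2])` has exactly `[E(ℝ) : 2E(ℝ)]` elements —
`2` for `Δ > 0` (a LINE in the Klein four-group `H¹(ℝ, E[2])`; which line is -desc's DESC-§18-T1, a Poonen–Rains statement not treated here),
`1` for `Δ < 0`. (`[R : ker(loc_∞) ⊓ R] = #loc_∞(R)`, Mathlib `AddSubgroup.relIndex_ker`, and §116.)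
[cite: MazurRubin2010, Lemma 3.2 (arXiv:0904.3709 p. 8)] -/
theorem natCard_map_localization_inl_selmerGroupRelaxedAtInfinityAtTwo_eq (w : InfinitePlace ℚ) :
    Nat.card ((selmerGroupRelaxedAtInfinityAtTwo W).map
        (galoisCohomology.localization (W.torsionGaloisModule ((2 : ℕ) : ℤ)) (Sum.inl w) 1)) =
      Nat.card (W.kummerSelmerStructure ((2 : ℕ) : ℤ) (Sum.inl w)) := by
  rw [← AddSubgroup.relIndex_ker, ← AddSubgroup.inf_relIndex_right,
    ← selmerGroup_kummerStrict_singleton_inl_eq_ker_inf W w]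
  exact relIndex_kummerStrict_selmerGroupRelaxedAtInfinityAtTwo_eq_natCard W w

/-- **`Δ > 0`: the image of `Sel₂^{rel ∞}(E)` in `H¹(ℝ, E[2]) ≅ 𝔽₂²` is a line (order `2`).** [cite: MazurRubin2010, Lemma 3.2 (arXiv:0904.3709 p. 8)]
[cite: Kramer1981, §2 Prop. 6 (p. 127)] -/
theorem natCard_map_localization_inl_selmerGroupRelaxedAtInfinityAtTwo_eq_two_of_Δ_pos (hΔ : 0 < W.Δ) (w : InfinitePlace ℚ) :
    Nat.card ((selmerGroupRelaxedAtInfinityAtTwo W).map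
        (galoisCohomology.localization (W.torsionGaloisModule ((2 : ℕ) : ℤ)) (Sum.inl w) 1)) = 2 := by
  rw [natCard_map_localization_inl_selmerGroupRelaxedAtInfinityAtTwo_eq W w]
  exact natCard_kummerSelmerStructure_inl_rat_eq_two_of_Δ_pos W hΔ w

end Image

end Summit.BirchSwinnertonDyer.BirchSwinnertonDyer.Theorems.GenusKolyArch

end
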